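import Summits.CriticalPhenomena.PercolationContinuityZ3.Theorems.PercNearOneGluingNoHeavyQuantWindowPieces
import HarnessLib

/-!
# QUANT lane R8, T-DEC: the ONE-SIDED (hence two-sided) MOVE inside the window polytope — elementary pieces whose signed pool change
# vanishes at every saturated layer can be followed a little without leaving `windowSet` (memo WINDOW-ATOMS-G57 §2.3–2.4, file H5 part 2)

builds on p205010 (kernel theorem, internal audit signed; external expert review pending)

Support file (`--supports stmt-CriticalPhenomena-4575`), QUANT lane seat prim-quant-census-2 (gen 57), rung R8 of
`run/shared/lean/prim/quant/LADDER.md`.  One theorem, standard axioms, no sorries.  Ingredients: `flowAtT_pert` / `pertLaw_nonneg`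
(`…QuantWindowPerturb(Law)`), `windowPhi_nonneg` / `decAtT_iff_of_noMid` (`…QuantWindowWitness`), `windowSet` / `vecLaw`
(`…QuantWindowAtomsExtreme`), bookkeeping `windowS` / `pieceG` / `pertD` (`…QuantWindowPieces`).

* **`LawDec.exists_oneSided`** — if `v ∈ windowSet`, the segments of the pieces carry corner flow, the absorber pieces sit on top absorbers
  with positive residual capacity, the low piece on a top low with positive leftover, and `pieceG J = 0` at every unflipped window layer `J`
  whose giant pool is nonempty and exactly saturated, then `v + α·pertD ∈ windowSet` for some `α > 0`.  Applied to the pieces and to their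
  negatives (`pertD_neg`, `pieceG_neg`) it is the two-sided move of memo §2.3.  Proof: every condition of `flowAtT_pert` (unflipped layers)
  and the strict all-giant inequality (flipped layers, `decAtT_iff_of_noMid`) hold for all small `η > 0` (`∀ᶠ η in 𝓝[>] 0`); the moved law
  `(μ + ηδ)/(1 + η Σδ)` is renormalised by `flowAtT_smul` and equals `v + α·pertD` with `α = η/(1 + ηΣδ)`.

[this work]; nothing here is cited as a published result.  The gluing rows served [cite: KozmaNitzan2024, Conjecture 3 (p. 15)]; product
measure [cite: Grimmett1999, §1.3 p. 10].
-/

noncomputable section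

open Filter Topology

namespace Summit.CriticalPhenomena.PercolationContinuityZ3.Theorems

namespace Quant

open Finset

namespace LawDec

/-- indicator of equality of naturals, as a real number -/
local notation3 "𝟙[" a ", " b "]" => (if (a : ℕ) = (b : ℕ) then (1 : ℝ) else 0)

/-! ### The one-sided move -/

/-- **THE ONE-SIDED MOVE** (memo §2.3–§2.4): under the structural hypotheses on the pieces, `v + α·pertD ∈ windowSet` for some `α > 0`.
[this work] -/
theorem exists_oneSided (x T : ℝ) (M j w : ℕ) (v : Fin (M + 1) → ℝ) (hx0 : 0 < x) (hx1 : x < 1)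
    (hv : v ∈ windowSet x T M j w) (l₁ h₁ l₂ h₂ g₁ g₂ l₀ : ℕ) (t₁ t₂ s₁ s₂ r : ℝ)
    (hσ₁ : t₁ ≠ 0 → 0 < cornerMidFlow x T j M (vecLaw M v) l₁ h₁)
    (hσ₂ : t₂ ≠ 0 → 0 < cornerMidFlow x T j M (vecLaw M v) l₂ h₂)
    (hg₁ : s₁ ≠ 0 → g₁ ≤ M ∧ ¬ (2 * (g₁ : ℝ) < T ∧ g₁ ≤ j) ∧
      0 < vecLaw M v g₁ - ∑ a ∈ Finset.range (j + 1), usage x T j a g₁ * cornerMidFlow x T j M (vecLaw M v) a g₁)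
    (hg₂ : s₂ ≠ 0 → g₂ ≤ M ∧ ¬ (2 * (g₂ : ℝ) < T ∧ g₂ ≤ j) ∧
      0 < vecLaw M v g₂ - ∑ a ∈ Finset.range (j + 1), usage x T j a g₂ * cornerMidFlow x T j M (vecLaw M v) a g₂)
    (hl₀ : r ≠ 0 → 2 * (l₀ : ℝ) < T ∧ l₀ ≤ j ∧ 0 < cornerLeftover x T j M (vecLaw M v) l₀)
    (hG : ∀ J, J ≤ j → j ≤ J + w → (∀ l, J < l → l ≤ j → 2 * (l : ℝ) < T → vecLaw M v l = 0) →
      x / (1 - x) * windowS x T j M (vecLaw M v) J = ∑ h ∈ Finset.Ico (J + 1) (M + 1), vecLaw M v h →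
      0 < ∑ h ∈ Finset.Ico (J + 1) (M + 1), vecLaw M v h →
      pieceG x T j M l₁ h₁ l₂ h₂ g₁ g₂ t₁ t₂ s₁ s₂ r J = 0) :
    ∃ α : ℝ, 0 < α ∧
      (fun i : Fin (M + 1) => v i + α * pertD x T j M v l₁ h₁ l₂ h₂ g₁ g₂ l₀ t₁ t₂ s₁ s₂ r i) ∈ windowSet x T M j w := by
  classical
  set μ : ℕ → ℝ := vecLaw M v with hμdef
  have hμ0 : ∀ k, 0 ≤ μ k := fun k => by
    by_cases hk : k < M + 1
    · rw [hμdef, vecLaw_apply_of_lt v hk]; exact hv.1 _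
    · rw [hμdef, vecLaw, dif_neg hk]
  have hμM : ∀ h, M < h → μ h = 0 := fun h hh => vecLaw_apply_of_gt v hh
  have hμ1 : ∑ h ∈ Finset.range (M + 1), μ h = 1 := by rw [hμdef, sum_range_vecLaw, hv.2.1]
  have hwin : ∀ J, J ≤ j → j ≤ J + w → DECAtT x T J M μ := hv.2.2
  have hu : 0 < x / (1 - x) := div_pos hx0 (by linarith)
  obtain ⟨hF0, hsup, hrow, hcol⟩ := cornerFlow_inv x T j M μ hx0 hx1 hμ0 ((j + 1) * (j + 1)) le_rfl
  -- abbreviations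
  set F : ℕ → ℕ → ℝ := cornerMidFlow x T j M μ with hFdef
  set δ : ℕ → ℝ := fun b => pertLaw x T j μ l₁ h₁ l₂ h₂ g₁ g₂ l₀ t₁ t₂ s₁ s₂ r b - μ b with hδdef
  set s : ℝ := ∑ k ∈ Finset.range (M + 1), δ k with hsdef
  -- facts on the pieces
  have hnogap : ∀ l, j < l → l ≤ j → 2 * (l : ℝ) < T → μ l = 0 := fun l h1 h2 _ => absurd h2 (not_le.2 h1)
  have seg₁ : t₁ ≠ 0 → l₁ ≤ j ∧ 2 * (l₁ : ℝ) < T ∧ h₁ ≤ M ∧ T < (l₁ : ℝ) + h₁ ∧ l₁ ≤ j ∧ h₁ ≤ j :=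
    fun ht => seg_of_flow_pos x T j j M μ hx0 hx1 hμ0 hnogap l₁ h₁ (hσ₁ ht)
  have seg₂ : t₂ ≠ 0 → l₂ ≤ j ∧ 2 * (l₂ : ℝ) < T ∧ h₂ ≤ M ∧ T < (l₂ : ℝ) + h₂ ∧ l₂ ≤ j ∧ h₂ ≤ j :=
    fun ht => seg_of_flow_pos x T j j M μ hx0 hx1 hμ0 hnogap l₂ h₂ (hσ₂ ht)
  -- a position of positive mass is ≤ M
  have hleM : ∀ b, 0 < μ b → b ≤ M := fun b hb => by
    by_contra hgt; push Not at hgt; linarith [hμM b hgt]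
  -- the load of a column is at most its mass; a segment's column has positive mass
  have hload_le : ∀ h, ∑ a ∈ Finset.range (j + 1), usage x T j a h * F a h ≤ μ h := fun h => hcol h
  have hterm0 : ∀ a h, 0 ≤ usage x T j a h * F a h := fun a h => by
    by_cases hz : F a h = 0
    · rw [hz, mul_zero]
    · obtain ⟨-, -, q3, -, q5, -⟩ := hsup a h hz
      have hah : a < h := by
        by_contra hge; push Not at hge
        have : (h : ℝ) ≤ a := by exact_mod_cast hge
        linarith
      exact mul_nonneg (usage_pos_of_compat x T j a h hx0 hx1 q3 hah (Or.inr q5)).le (hF0 a h)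
  have hmass_seg : ∀ l h, 0 < F l h → 0 < μ h := fun l h hF => by
    obtain ⟨q1, -, q3, -, q5, -⟩ := hsup l h (ne_of_gt hF)
    have hlh : l < h := by
      by_contra hge; push Not at hge
      have : (h : ℝ) ≤ l := by exact_mod_cast hge
      linarith
    have hpos : 0 < usage x T j l h * F l h := mul_pos (usage_pos_of_compat x T j l h hx0 hx1 q3 hlh (Or.inr q5)) hF
    have hle := Finset.single_le_sum (f := fun a => usage x T j a h * F a h) (fun a _ => hterm0 a h)
      (Finset.mem_range.2 (Nat.lt_succ_of_le q1))
    linarith [hload_le h]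
  -- the leftover mass is dominated by the giant mass above `j` (corner certificate at the top layer)
  have hleft0 : ∀ l, 0 ≤ cornerLeftover x T j M μ l := fun l => by
    unfold cornerLeftover cornerMidFlow; linarith [hrow l]
  have hCj : x / (1 - x) * ∑ l ∈ (Finset.range (j + 1)).filter (fun l : ℕ => 2 * (l : ℝ) < T), cornerLeftover x T j M μ l
      ≤ ∑ h ∈ Finset.Ico (j + 1) (M + 1), μ h :=
    (decAtT_iff_cornerSucceeds x T j M μ hx0 hx1 hμ0 hμM hμ1).1 (hwin j le_rfl (Nat.le_add_right _ _))
  have hgiant_of_left : ∀ l : ℕ, 2 * (l : ℝ) < T → l ≤ j → 0 < cornerLeftover x T j M μ l →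
      ∀ J : ℕ, J ≤ j → 0 < ∑ h ∈ Finset.Ico (J + 1) (M + 1), μ h := by
    intro l hlow hlj hL J hJ
    have hmem : l ∈ (Finset.range (j + 1)).filter (fun l : ℕ => 2 * (l : ℝ) < T) :=
      Finset.mem_filter.2 ⟨Finset.mem_range.2 (Nat.lt_succ_of_le hlj), hlow⟩
    have hle := Finset.single_le_sum (f := fun l : ℕ => cornerLeftover x T j M μ l) (fun l _ => hleft0 l) hmem
    have hsub : ∑ h ∈ Finset.Ico (j + 1) (M + 1), μ h ≤ ∑ h ∈ Finset.Ico (J + 1) (M + 1), μ h :=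
      Finset.sum_le_sum_of_subset_of_nonneg (Finset.Ico_subset_Ico (by omega) le_rfl) (fun h _ _ => hμ0 h)
    nlinarith [mul_pos hu hL]
  have hpos_l : ∀ l h, 0 < F l h → 0 < μ l := fun l h hF => by
    obtain ⟨-, -, -, q4, -, -⟩ := hsup l h (ne_of_gt hF)
    have hle := Finset.single_le_sum (f := fun b => cornerFlow x T j M μ ((j + 1) * (j + 1)) l b) (fun b _ => hF0 l b)
      (Finset.mem_range.2 (Nat.lt_succ_of_le q4))
    have hF' : 0 < cornerFlow x T j M μ ((j + 1) * (j + 1)) l h := hF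
    linarith [hrow l]
  have hLft_le : ∀ l, cornerLeftover x T j M μ l ≤ μ l := fun l => by
    have : 0 ≤ ∑ b ∈ Finset.range (M + 1), cornerFlow x T j M μ ((j + 1) * (j + 1)) l b :=
      Finset.sum_nonneg fun b _ => hF0 l b
    unfold cornerLeftover cornerMidFlow; linarith
  have hl₀M : r ≠ 0 → l₀ ≤ M := fun hr => hleM l₀ (lt_of_lt_of_le (hl₀ hr).2.2 (hLft_le l₀))
  -- δ vanishes above M
  have hδM : ∀ b, M < b → δ b = 0 := by
    intro b hb
    have hne : ∀ p, p ≤ M → b ≠ p := fun p hp hbp => by omega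
    have z1 : t₁ * (𝟙[b, l₁] + usage x T j l₁ h₁ * 𝟙[b, h₁]) = 0 := by
      by_cases ht : t₁ = 0
      · rw [ht, zero_mul]
      · rw [if_neg (hne l₁ (hleM l₁ (hpos_l l₁ h₁ (hσ₁ ht)))), if_neg (hne h₁ (seg₁ ht).2.2.1)]; ring
    have z2 : t₂ * (𝟙[b, l₂] + usage x T j l₂ h₂ * 𝟙[b, h₂]) = 0 := by
      by_cases ht : t₂ = 0
      · rw [ht, zero_mul]
      · rw [if_neg (hne l₂ (hleM l₂ (hpos_l l₂ h₂ (hσ₂ ht)))), if_neg (hne h₂ (seg₂ ht).2.2.1)]; ring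
    have z3 : s₁ * 𝟙[b, g₁] = 0 := by
      by_cases hs : s₁ = 0
      · rw [hs, zero_mul]
      · rw [if_neg (hne g₁ (hg₁ hs).1), mul_zero]
    have z4 : s₂ * 𝟙[b, g₂] = 0 := by
      by_cases hs : s₂ = 0
      · rw [hs, zero_mul]
      · rw [if_neg (hne g₂ (hg₂ hs).1), mul_zero]
    have z0 : r * 𝟙[b, l₀] = 0 := by
      by_cases hr : r = 0
      · rw [hr, zero_mul]
      · rw [if_neg (hne l₀ (hl₀M hr)), mul_zero]
    show pertLaw x T j μ l₁ h₁ l₂ h₂ g₁ g₂ l₀ t₁ t₂ s₁ s₂ r b - μ b = 0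
    unfold pertLaw; rw [z1, z2, z3, z4, z0]; ring
  -- the residual capacity of a column
  set resid : ℕ → ℝ := fun h => μ h - ∑ a ∈ Finset.range (j + 1), usage x T j a h * F a h with hresid
  have hresid0 : ∀ h, 0 ≤ resid h := fun h => by simp only [hresid]; linarith [hload_le h]
  /- ### the conditions hold for every small `η > 0` -/
  -- (H1)
  have gH1 : ∀ᶠ η in 𝓝[>] (0:ℝ), ∀ a b, 0 ≤ F a b + η * t₁ * 𝟙[a, l₁] * 𝟙[b, h₁] + η * t₂ * 𝟙[a, l₂] * 𝟙[b, h₂] := by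
    have key : ∀ a b, ∀ᶠ η in 𝓝[>] (0:ℝ), 0 ≤ F a b + η * t₁ * 𝟙[a, l₁] * 𝟙[b, h₁] + η * t₂ * 𝟙[a, l₂] * 𝟙[b, h₂] := by
      intro a b
      have h := eventually_nhdsGT_nonneg_add_mul (b := F a b) (k := t₁ * 𝟙[a, l₁] * 𝟙[b, h₁] + t₂ * 𝟙[a, l₂] * 𝟙[b, h₂])
        (hF0 a b) (fun hz => by
          obtain ⟨q1, q2⟩ := bumps_eq_zero_of_flow_eq_zero x T j M μ l₁ h₁ l₂ h₂ t₁ t₂ hσ₁ hσ₂ a b hz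
          rw [q1, q2, add_zero])
      exact h.mono fun η hη => by linarith
    have hfin : ∀ᶠ η in 𝓝[>] (0:ℝ), ∀ a ∈ Finset.range (j + 1), ∀ b ∈ Finset.range (M + 1),
        0 ≤ F a b + η * t₁ * 𝟙[a, l₁] * 𝟙[b, h₁] + η * t₂ * 𝟙[a, l₂] * 𝟙[b, h₂] :=
      (Finset.eventually_all _).2 fun a _ => (Finset.eventually_all _).2 fun b _ => key a b
    refine hfin.mono fun η hη a b => ?_
    by_cases hab : a ∈ Finset.range (j + 1) ∧ b ∈ Finset.range (M + 1)
    · exact hη a hab.1 b hab.2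
    · -- off the board everything vanishes
      have hFz : F a b = 0 := by
        by_contra hne
        obtain ⟨q1, -, -, q4, -, -⟩ := hsup a b hne
        exact hab ⟨Finset.mem_range.2 (Nat.lt_succ_of_le q1), Finset.mem_range.2 (Nat.lt_succ_of_le q4)⟩
      obtain ⟨q1, q2⟩ := bumps_eq_zero_of_flow_eq_zero x T j M μ l₁ h₁ l₂ h₂ t₁ t₂ hσ₁ hσ₂ a b hFz
      have e : η * t₁ * 𝟙[a, l₁] * 𝟙[b, h₁] + η * t₂ * 𝟙[a, l₂] * 𝟙[b, h₂]
          = η * (t₁ * 𝟙[a, l₁] * 𝟙[b, h₁]) + η * (t₂ * 𝟙[a, l₂] * 𝟙[b, h₂]) := by ring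
      rw [add_assoc, e, q1, q2, hFz]; simp
  -- (H2)
  have gH2 : ∀ᶠ η in 𝓝[>] (0:ℝ), ∀ a, 0 ≤ cornerLeftover x T j M μ a + η * r * 𝟙[a, l₀] := by
    have h := eventually_nhdsGT_nonneg_add_mul (b := cornerLeftover x T j M μ l₀) (k := r) (hleft0 l₀)
      (fun hz => by by_contra hr; linarith [(hl₀ hr).2.2])
    refine h.mono fun η hη a => ?_
    by_cases ha : a = l₀
    · rw [ha, if_pos rfl, mul_one]; exact hη
    · rw [if_neg ha, mul_zero, add_zero]; exact hleft0 a
  -- (H3)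
  have gH3 : ∀ᶠ η in 𝓝[>] (0:ℝ), ∀ h, 0 ≤ resid h + η * s₁ * 𝟙[h, g₁] + η * s₂ * 𝟙[h, g₂] := by
    have key : ∀ h, ∀ᶠ η in 𝓝[>] (0:ℝ), 0 ≤ resid h + η * s₁ * 𝟙[h, g₁] + η * s₂ * 𝟙[h, g₂] := by
      intro h
      have h' := eventually_nhdsGT_nonneg_add_mul (b := resid h) (k := s₁ * 𝟙[h, g₁] + s₂ * 𝟙[h, g₂]) (hresid0 h)
        (fun hz => by
          have z1 : s₁ * 𝟙[h, g₁] = 0 := by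
            by_cases hs : s₁ = 0
            · rw [hs, zero_mul]
            · rw [if_neg (fun hh => by have := (hg₁ hs).2.2; rw [← hh] at this; simp only [hresid] at hz; linarith),
                mul_zero]
          have z2 : s₂ * 𝟙[h, g₂] = 0 := by
            by_cases hs : s₂ = 0
            · rw [hs, zero_mul]
            · rw [if_neg (fun hh => by have := (hg₂ hs).2.2; rw [← hh] at this; simp only [hresid] at hz; linarith),
                mul_zero]
          rw [z1, z2, add_zero])
      exact h'.mono fun η hη => by linarith
    have hfin : ∀ᶠ η in 𝓝[>] (0:ℝ), ∀ h ∈ ({g₁, g₂} : Finset ℕ), 0 ≤ resid h + η * s₁ * 𝟙[h, g₁] + η * s₂ * 𝟙[h, g₂] :=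
      (Finset.eventually_all _).2 fun h _ => key h
    refine hfin.mono fun η hη h => ?_
    by_cases hh : h ∈ ({g₁, g₂} : Finset ℕ)
    · exact hη h hh
    · rw [Finset.mem_insert, Finset.mem_singleton, not_or] at hh
      rw [if_neg hh.1, if_neg hh.2, mul_zero, mul_zero, add_zero, add_zero]; exact hresid0 h
  -- (H5) at the unflipped window layers
  have gH5 : ∀ᶠ η in 𝓝[>] (0:ℝ), ∀ J ∈ Finset.range (j + 1), j ≤ J + w →
      (∀ l, J < l → l ≤ j → 2 * (l : ℝ) < T → μ l = 0) →
      0 ≤ (∑ h ∈ Finset.Ico (J + 1) (M + 1), μ h - x / (1 - x) * windowS x T j M μ J)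
        + η * pieceG x T j M l₁ h₁ l₂ h₂ g₁ g₂ t₁ t₂ s₁ s₂ r J := by
    refine (Finset.eventually_all _).2 fun J hJ => ?_
    have hJj : J ≤ j := Nat.lt_succ_iff.1 (Finset.mem_range.1 hJ)
    by_cases hw : j ≤ J + w
    · by_cases hgap : ∀ l, J < l → l ≤ j → 2 * (l : ℝ) < T → μ l = 0
      · have hΦ : 0 ≤ ∑ h ∈ Finset.Ico (J + 1) (M + 1), μ h - x / (1 - x) * windowS x T j M μ J := by
          have := windowPhi_nonneg x T J j M μ hx0 hx1 hμ0 hμM hμ1 hJj hgap (hwin J hJj hw)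
          unfold windowS; linarith
        have h := eventually_nhdsGT_nonneg_add_mul hΦ (fun hz => by
          -- the pool of `J` is exactly saturated: `G_J = 0` by `hG` if the pool is nonempty, by vanishing of the pieces otherwise
          have hΓ0 : 0 ≤ ∑ h ∈ Finset.Ico (J + 1) (M + 1), μ h := Finset.sum_nonneg fun h _ => hμ0 h
          rcases hΓ0.lt_or_eq with hΓpos | hΓzero
          · exact hG J hJj hw hgap (by linarith) hΓpos
          · -- no mass above `J`: every piece sits at a position `≤ J` and `r = 0`
            have hbelow : ∀ b, 0 < μ b → ¬ (J < b) := by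
              intro b hb hJb
              have hmem : b ∈ Finset.Ico (J + 1) (M + 1) := Finset.mem_Ico.2 ⟨hJb, Nat.lt_succ_of_le (hleM b hb)⟩
              have := Finset.single_le_sum (f := fun h => μ h) (fun h _ => hμ0 h) hmem
              linarith
            have w1 : ¬ (t₁ ≠ 0 ∧ J < h₁) := fun hc => hbelow h₁ (hmass_seg l₁ h₁ (hσ₁ hc.1)) hc.2
            have w2 : ¬ (t₂ ≠ 0 ∧ J < h₂) := fun hc => hbelow h₂ (hmass_seg l₂ h₂ (hσ₂ hc.1)) hc.2
            have w3 : ¬ (s₁ ≠ 0 ∧ J < g₁) := fun hc =>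
              hbelow g₁ (by have := (hg₁ hc.1).2.2; linarith [hload_le g₁, Finset.sum_nonneg (fun a (_ : a ∈ Finset.range (j+1)) => hterm0 a g₁)]) hc.2
            have w4 : ¬ (s₂ ≠ 0 ∧ J < g₂) := fun hc =>
              hbelow g₂ (by have := (hg₂ hc.1).2.2; linarith [hload_le g₂, Finset.sum_nonneg (fun a (_ : a ∈ Finset.range (j+1)) => hterm0 a g₂)]) hc.2
            have w0 : r = 0 := by
              by_contra hr
              have := hgiant_of_left l₀ (hl₀ hr).1 (hl₀ hr).2.1 (hl₀ hr).2.2 J hJj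
              linarith
            unfold pieceG
            have e1 : (if J < h₁ ∧ h₁ ≤ M then t₁ * usage x T j l₁ h₁ else 0) - (if J < h₁ then x / (1 - x) * t₁ else 0) = 0 := by
              by_cases ht : t₁ = 0
              · simp [ht]
              · rw [if_neg (fun hc => w1 ⟨ht, hc.1⟩), if_neg (fun hc => w1 ⟨ht, hc⟩), sub_zero]
            have e2 : (if J < h₂ ∧ h₂ ≤ M then t₂ * usage x T j l₂ h₂ else 0) - (if J < h₂ then x / (1 - x) * t₂ else 0) = 0 := by
              by_cases ht : t₂ = 0
              · simp [ht]
              · rw [if_neg (fun hc => w2 ⟨ht, hc.1⟩), if_neg (fun hc => w2 ⟨ht, hc⟩), sub_zero]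
            have e3 : (if J < g₁ ∧ g₁ ≤ M then s₁ else 0) = 0 := by
              by_cases hs : s₁ = 0
              · simp [hs]
              · rw [if_neg (fun hc => w3 ⟨hs, hc.1⟩)]
            have e4 : (if J < g₂ ∧ g₂ ≤ M then s₂ else 0) = 0 := by
              by_cases hs : s₂ = 0
              · simp [hs]
              · rw [if_neg (fun hc => w4 ⟨hs, hc.1⟩)]
            rw [e1, e2, e3, e4, w0]; ring)
        exact h.mono fun η hη _ _ => hη
      · exact Filter.Eventually.of_forall fun η _ hg => absurd hg hgap
    · exact Filter.Eventually.of_forall fun η hw' => absurd hw' hw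
  -- the flipped window layers: the all-giant inequality is strict at `μ`
  have gFl : ∀ᶠ η in 𝓝[>] (0:ℝ), ∀ J ∈ Finset.range (j + 1), j ≤ J + w →
      (∃ l, J < l ∧ l ≤ j ∧ 2 * (l : ℝ) < T ∧ μ l ≠ 0) →
      x / (1 - x) * ∑ l ∈ (Finset.range (J + 1)).filter (fun l : ℕ => 2 * (l : ℝ) < T), (μ l + η * δ l)
        ≤ ∑ h ∈ Finset.Ico (J + 1) (M + 1), (μ h + η * δ h) := by
    refine (Finset.eventually_all _).2 fun J hJ => ?_
    have hJj : J ≤ j := Nat.lt_succ_iff.1 (Finset.mem_range.1 hJ)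
    by_cases hw : j ≤ J + w
    · by_cases hfl : ∃ l, J < l ∧ l ≤ j ∧ 2 * (l : ℝ) < T ∧ μ l ≠ 0
      · obtain ⟨lf, hJlf, hlfj, hlow, hne⟩ := hfl
        have hpos : 0 < μ lf := lt_of_le_of_ne (hμ0 lf) (Ne.symm hne)
        have hgap' := allGiant_gap x T J lf M μ hx0 hx1 hμ0 hμM hμ1 hJlf hlow hpos (hwin lf hlfj (by omega))
        have h := eventually_nhdsGT_pos_add_mul hgap'
          (∑ h ∈ Finset.Ico (J + 1) (M + 1), δ h - x / (1 - x) * ∑ l ∈ (Finset.range (J + 1)).filter (fun l : ℕ => 2 * (l : ℝ) < T), δ l)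
        refine h.mono fun η hη _ _ => ?_
        rw [Finset.sum_add_distrib, Finset.sum_add_distrib, ← Finset.mul_sum, ← Finset.mul_sum]
        nlinarith
      · exact Filter.Eventually.of_forall fun η _ hf => absurd hf hfl
    · exact Filter.Eventually.of_forall fun η hw' => absurd hw' hw
  -- positivity of η and of the normalisation
  have g0 : ∀ᶠ η in 𝓝[>] (0:ℝ), 0 < η := eventually_mem_nhdsWithin
  have g1 : ∀ᶠ η in 𝓝[>] (0:ℝ), 0 < 1 + η * s := eventually_nhdsGT_pos_add_mul one_pos s
  obtain ⟨η, hη0, hη1, H1, H2, H3, H5, HF⟩ := (g0.and (g1.and (gH1.and (gH2.and (gH3.and (gH5.and gFl)))))).exists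
  /- ### the moved law -/
  have hc : 0 < 1 / (1 + η * s) := div_pos one_pos hη1
  set ν : ℕ → ℝ := fun b => (μ b + η * δ b) / (1 + η * s) with hνdef
  -- the un-normalised law is the perturbed law with coefficients η·(pieces)
  have hpl : ∀ b, pertLaw x T j μ l₁ h₁ l₂ h₂ g₁ g₂ l₀ (η * t₁) (η * t₂) (η * s₁) (η * s₂) (η * r) b = μ b + η * δ b :=
    fun b => pertLaw_smul x T j μ l₁ h₁ l₂ h₂ g₁ g₂ l₀ t₁ t₂ s₁ s₂ r η b
  have hσ₁' : η * t₁ ≠ 0 → 0 < cornerMidFlow x T j M μ l₁ h₁ := fun h => hσ₁ (right_ne_zero_of_mul h)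
  have hσ₂' : η * t₂ ≠ 0 → 0 < cornerMidFlow x T j M μ l₂ h₂ := fun h => hσ₂ (right_ne_zero_of_mul h)
  have hg₁' : η * s₁ ≠ 0 → g₁ ≤ M ∧ ¬ (2 * (g₁ : ℝ) < T ∧ g₁ ≤ j) := fun h => ⟨(hg₁ (right_ne_zero_of_mul h)).1, (hg₁ (right_ne_zero_of_mul h)).2.1⟩
  have hg₂' : η * s₂ ≠ 0 → g₂ ≤ M ∧ ¬ (2 * (g₂ : ℝ) < T ∧ g₂ ≤ j) := fun h => ⟨(hg₂ (right_ne_zero_of_mul h)).1, (hg₂ (right_ne_zero_of_mul h)).2.1⟩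
  have hl₀' : η * r ≠ 0 → 2 * (l₀ : ℝ) < T ∧ l₀ ≤ j ∧ 0 < μ l₀ := fun h =>
    ⟨(hl₀ (right_ne_zero_of_mul h)).1, (hl₀ (right_ne_zero_of_mul h)).2.1,
      lt_of_lt_of_le (hl₀ (right_ne_zero_of_mul h)).2.2 (hLft_le l₀)⟩
  have H1' : ∀ a b, 0 ≤ cornerMidFlow x T j M μ a b + η * t₁ * 𝟙[a, l₁] * 𝟙[b, h₁] + η * t₂ * 𝟙[a, l₂] * 𝟙[b, h₂] := H1
  have H3' : ∀ h, 0 ≤ μ h - ∑ a ∈ Finset.range (j + 1), usage x T j a h * cornerMidFlow x T j M μ a h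
      + η * s₁ * 𝟙[h, g₁] + η * s₂ * 𝟙[h, g₂] := H3
  -- nonnegativity, support, mass
  have hν0 : ∀ b, 0 ≤ ν b := fun b => by
    have := pertLaw_nonneg x T j M μ l₁ h₁ l₂ h₂ g₁ g₂ l₀ (η * t₁) (η * t₂) (η * s₁) (η * s₂) (η * r) hx0 hx1 hμ0
      hσ₁' hσ₂' hg₁' hg₂' (fun h => ⟨(hl₀' h).1, (hl₀' h).2.1⟩) H1' H2 H3' b
    rw [hpl] at this
    exact div_nonneg this hη1.le
  have hνM : ∀ b, M < b → ν b = 0 := fun b hb => by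
    simp only [hνdef]; rw [hμM b hb, hδM b hb]; simp
  have hν1 : ∑ b ∈ Finset.range (M + 1), ν b = 1 := by
    simp only [hνdef]
    rw [← Finset.sum_div, Finset.sum_add_distrib, ← Finset.mul_sum, hμ1]
    exact div_self (ne_of_gt hη1)
  -- DEC at every window layer
  have hνdec : ∀ J, J ≤ j → j ≤ J + w → DECAtT x T J M ν := by
    intro J hJj hw
    have hJmem : J ∈ Finset.range (j + 1) := Finset.mem_range.2 (Nat.lt_succ_of_le hJj)
    by_cases hfl : ∃ l, J < l ∧ l ≤ j ∧ 2 * (l : ℝ) < T ∧ μ l ≠ 0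
    · -- flipped: all-giant layer, the inequality is inherited
      have hno : ∀ h, h ≤ J → T ≤ 2 * (h : ℝ) → ν h = 0 := by
        obtain ⟨lf, hJlf, -, hlow, -⟩ := hfl
        intro h hh hT; exfalso
        have : (h : ℝ) ≤ J := by exact_mod_cast hh
        have : (J : ℝ) < lf := by exact_mod_cast hJlf
        linarith
      refine (decAtT_iff_of_noMid x T J M ν hx0 hx1 hν0 hνM hν1 hno).2 ?_
      have hineq := HF J hJmem hw hfl
      simp only [hνdef]
      rw [← Finset.sum_div, ← Finset.sum_div, mul_div_assoc']
      exact div_le_div_of_nonneg_right hineq hη1.le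
    · -- unflipped: the perturbed witness, scaled
      push Not at hfl
      have hgap : ∀ l, J < l → l ≤ j → 2 * (l : ℝ) < T → μ l = 0 := hfl
      have hΦ := H5 J hJmem hw hgap
      have hflow : FlowAtT x T J M (pertLaw x T j μ l₁ h₁ l₂ h₂ g₁ g₂ l₀ (η * t₁) (η * t₂) (η * s₁) (η * s₂) (η * r)) := by
        refine flowAtT_pert x T J j M μ l₁ h₁ l₂ h₂ g₁ g₂ l₀ (η * t₁) (η * t₂) (η * s₁) (η * s₂) (η * r) hx0 hx1 hμ0 hJj hgap
          hσ₁' hσ₂' hg₁' hg₂' hl₀' H1' H2 H3' ?_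
        -- (H5) from `0 ≤ Φ_J + η G_J`
        unfold windowS at hΦ
        set S := ∑ l ∈ (Finset.range (j + 1)).filter (fun l : ℕ => 2 * (l : ℝ) < T),
          (cornerLeftover x T j M μ l + ∑ h ∈ Finset.range (M + 1), (if J < h ∧ h ≤ j then cornerMidFlow x T j M μ l h else 0))
          with hS
        set Γ := ∑ h ∈ Finset.Ico (J + 1) (M + 1), μ h with hΓ
        have hG' : (Γ + (if J < h₁ ∧ h₁ ≤ M then η * t₁ * usage x T j l₁ h₁ else 0)
              + (if J < h₂ ∧ h₂ ≤ M then η * t₂ * usage x T j l₂ h₂ else 0)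
              + (if J < g₁ ∧ g₁ ≤ M then η * s₁ else 0) + (if J < g₂ ∧ g₂ ≤ M then η * s₂ else 0))
            - x / (1 - x) * (S + (if J < h₁ then η * t₁ else 0) + (if J < h₂ then η * t₂ else 0) + η * r)
            = (Γ - x / (1 - x) * S) + η * pieceG x T j M l₁ h₁ l₂ h₂ g₁ g₂ t₁ t₂ s₁ s₂ r J := by
          unfold pieceG; split_ifs <;> ring
        linarith [hΦ, hG']
      have hflow' : FlowAtT x T J M ν := by
        have h := flowAtT_smul x T J M _ (1 / (1 + η * s)) hc hflow
        have e : (fun b => 1 / (1 + η * s) * pertLaw x T j μ l₁ h₁ l₂ h₂ g₁ g₂ l₀ (η * t₁) (η * t₂) (η * s₁) (η * s₂) (η * r) b) = ν := by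
          funext b; rw [hpl b]; simp only [hνdef]; ring
        rw [e] at h; exact h
      exact (decAtT_iff_flowAtT x T J M ν hx0 hx1 hνM hν1).2 hflow'
  /- ### the conclusion: `v + α·D = ν` with `α = η/(1+ηs)` -/
  refine ⟨η / (1 + η * s), div_pos hη0 hη1, ?_⟩
  have hvec : (fun i : Fin (M + 1) => v i + η / (1 + η * s) * pertD x T j M v l₁ h₁ l₂ h₂ g₁ g₂ l₀ t₁ t₂ s₁ s₂ r i)
      = fun i : Fin (M + 1) => ν i := by
    funext i
    have hvi : v i = μ i := by rw [hμdef, vecLaw_fin]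
    simp only [hνdef, pertD]
    rw [hvi]
    field_simp
    ring
  rw [hvec]
  refine ⟨fun i => hν0 i, ?_, fun J hJ hw => ?_⟩
  · have := sum_range_vecLaw (fun i : Fin (M + 1) => ν i)
    rw [vecLaw_restrict ν hνM] at this
    rw [← this, hν1]
  · rw [vecLaw_restrict ν hνM]
    exact hνdec J hJ hw

end LawDec

end Quant

end Summit.CriticalPhenomena.PercolationContinuityZ3.Theorems
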